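import Summits.QuantumAdvantage.QuantumAdvantage.Theorems.SosSandwichTransferPBDefs
import Summits.QuantumAdvantage.QuantumAdvantage.Theorems.SosSandwichTransferPBFarCoinMachine
import Literature.Computability.Complexity.BPPSubsetAlmostP
import Literature.Computability.Complexity.PromiseCookMachine

/-!
# Crux `TransferPB` (stmt-QuantumAdvantage-15238, route SosSandwich), line `birth` — stub `stub_promiseOracleElimination`

PROMISE-`BPP'` ORACLE ELIMINATION RELATIVE TO A RANDOM ORACLE (registered signature
`Sig.stub_promiseOracleElimination`, `Theorems/SosSandwichTransferPBDefs.lean`; verbatim piece 2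
`PromiseOracleElimination` of the sibling split of `PromiseTransfer`). For `Q ∈ PromiseBPP'`, a polynomial-time
deterministic transcript machine `C` (round/query budget `q`) consulting the combined oracle `A ⊕ g`
(`false :: v ↦ [v ∈ A]`, `true :: v ↦ g v`), and polynomials `ℓ, r`: one polynomial-time `C'` with the random
oracle `A` ALONE reproduces, output for output, every halting run of `C^{A ⊕ ĝ(A)}(x)`, where the answer
function `ĝ(A)` is computed from a finite window `V` of oracle positions of length `> ℓ(|x|)` and violates the
promise of `Q` with probability `≤ 1/(r(|x|) + 1)`.

Proof (Bennett–Gill 1981, Thm. 5, "coins read off the oracle", input by input):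
* the amplified decider `(L'', p'')` with error `≤ e^{-(|z|+1)}` (`PromiseBPPAmplificationExp.lean`, error
  polynomial `X`) of the padded SHIFTED problem `(shift Q).padded` — instances `⟨true :: v, t⟩`, so that the
  tag `t = 1^{T(n)}`, `T = q + r + ℓ + 1`, drives the error below `e^{-(T(n)+5)}`;
* the far-coin machine of `Theorems/SosSandwichTransferPBFarCoinMachine.lean` (`FarCoin.exists_simulator`
  with the dispatcher `ttFnAlg dispQ (p''+1) (dispG L'')` as subroutine): a query `false :: v` is answered by
  asking `v`; a query `true :: v` by running `L''` on `⟨true :: v, t⟩` with the oracle bits at the fresh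
  addresses `⟨⟨true :: v, t⟩, 1ⁱ⟩` (all of length `> T(n) > ℓ(n)`) as coins;
* `ĝ(A) v` is that simulated verdict for `|v| < q(n)` and the truth elsewhere, `V` the set of addresses;
* the single-string error is a counting probability over the window (`BPPAlmostP.toReal_measure_setOf_err`,
  `randomOracleMeasure_restrictBool`), `≤ e^{-(T(n)+5)}`; the union bound over the `≤ 2^{q(n)+1}` short
  strings (`PromiseCook.shortStrings`) gives `2^{q(n)+1} e^{-(q(n)+r(n)+ℓ(n)+6)} ≤ e^{-(r(n)+1)} ≤ 1/(r(n)+1)`.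

Sources: C. H. Bennett, J. Gill, SIAM J. Comput. 10 (1981) 96–113, Thm. 5; R. V. Book, H. Vollmer,
K. W. Wagner, ICALP 1996, LNCS 1099, §4 Thm. 3; S. Arora, B. Barak, *Computational Complexity* (2009),
Thm. 7.10, §3.4, §7.4.1; O. Goldreich, *On promise problems*, LNCS 3895 (2006), §1.2.
-/

-- D-0017: single-conjunct summit ⇒ the duplicate `QuantumAdvantage.QuantumAdvantage` is mandated.
set_option linter.dupNamespace false

noncomputable section

namespace Summit.QuantumAdvantage.QuantumAdvantage.Cruxes.TransferPB.Birth

open MeasureTheory Literature.Computability.Complexity Literature.Computability.QuantumComplexity Computability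
  Polynomial PRelSigma OracleCompose TTClosure OracleAlg Finset Real
open scoped ENNReal

namespace FarCoin

/-! ### The shifted problem and its amplified decider -/

/-- **The shifted problem** `shift Q = {true :: v | v ∈ Q}`: the instances of `Q` behind the selector bit
`true` of the combined oracle `A ⊕ g`. [cite: GoldreichPromise2006, §1.2 Def. 3 (Karp reductions among promise problems)] -/
def shift (Q : PromiseProblem) : PromiseProblem :=
  ⟨{u | ∃ v ∈ Q.yes, u = true :: v}, {u | ∃ v ∈ Q.no, u = true :: v}⟩

/-- `true :: v` is a YES instance of `shift Q` iff `v` is a YES instance of `Q`. [folklore] -/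
theorem cons_mem_shift_yes (Q : PromiseProblem) (v : List Bool) : true :: v ∈ (shift Q).yes ↔ v ∈ Q.yes := by
  constructor
  · rintro ⟨v', hv', h⟩
    rw [(List.cons_injective).eq_iff.1 h]  -- placeholder, fixed below if needed
    exact hv'
  · exact fun h => ⟨v, h, rfl⟩

/-- `true :: v` is a NO instance of `shift Q` iff `v` is a NO instance of `Q`. [folklore] -/
theorem cons_mem_shift_no (Q : PromiseProblem) (v : List Bool) : true :: v ∈ (shift Q).no ↔ v ∈ Q.no := by
  constructor
  · rintro ⟨v', hv', h⟩
    rw [(List.cons_injective).eq_iff.1 h]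
    exact hv'
  · exact fun h => ⟨v, h, rfl⟩

/-- **`shift Q` Karp-reduces to `Q`** by `List.tail ∈ FP`. [cite: GoldreichPromise2006, §1.2 Def. 3] -/
theorem shift_polyTimeReducible (Q : PromiseProblem) : (shift Q).PolyTimeReducible Q := by
  refine ⟨List.tail, tail_mem_FP, ?_, ?_⟩
  · rintro u ⟨v, hv, rfl⟩; exact hv
  · rintro u ⟨v, hv, rfl⟩; exact hv

/-- **The amplified decider of the padded shifted problem**: for `Q ∈ PromiseBPP'` there are `L'' ∈ P` and a
coin polynomial `p''` deciding the instances `z = ⟨true :: v, t⟩` with two-sided error `≤ e^{-(|z|+1)}` on the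
promise of `Q` (in `v`), the verdict depending on the first `p''(|z|)` coins only (Arora–Barak Thm. 7.10 via
`PromiseProblem.exists_amplifier_exp_of_mem_PromiseBPP'`, on `(shift Q).padded ∈ PromiseBPP'`).
[cite: AroraBarak2009, Thm. 7.10] -/
theorem exists_amplifier (Q : PromiseProblem) (hQ : Q ∈ PromiseBPP') :
    ∃ L'' ∈ Classes.P, ∃ p'' : Polynomial ℕ,
      (∀ v ∈ Q.yes, ∀ t : List Bool,
        uniformProb (p''.eval (boolPair (true :: v) t).length) {y | boolPair (boolPair (true :: v) t) y ∉ L''} ≤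
          exp (-(((boolPair (true :: v) t).length : ℝ) + 1))) ∧
      (∀ v ∈ Q.no, ∀ t : List Bool,
        uniformProb (p''.eval (boolPair (true :: v) t).length) {y | boolPair (boolPair (true :: v) t) y ∈ L''} ≤
          exp (-(((boolPair (true :: v) t).length : ℝ) + 1))) ∧
      (∀ z y : List Bool, ∀ N, p''.eval z.length ≤ N → (boolPair z (y.take N) ∈ L'' ↔ boolPair z y ∈ L'')) := by
  have hQ' : (shift Q).padded ∈ PromiseBPP' :=
    PromiseProblem.padded_mem_PromiseBPP' (PromiseProblem.mem_PromiseBPP'_of_polyTimeReducible_holds' (shift_polyTimeReducible Q) hQ)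
  obtain ⟨L'', hL'', p'', hyes, hno, htake⟩ := PromiseProblem.exists_amplifier_exp_of_mem_PromiseBPP' hQ' X
  refine ⟨L'', hL'', p'', fun v hv t => ?_, fun v hv t => ?_, htake⟩
  · have h := hyes (boolPair (true :: v) t)
      ((PromiseProblem.boolPair_mem_padded_yes _ _ _).2 ((cons_mem_shift_yes Q v).2 hv))
    simpa only [eval_X] using h
  · have h := hno (boolPair (true :: v) t)
      ((PromiseProblem.boolPair_mem_padded_no _ _ _).2 ((cons_mem_shift_no Q v).2 hv))
    simpa only [eval_X] using h

/-! ### The combined oracle -/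

/-- The language of the combined oracle `A ⊕ g` (verbatim the set of the registered signature). [folklore] -/
def comb (A : Set (List Bool)) (g : List Bool → Bool) : Set (List Bool) :=
  {w : List Bool | ∃ v : List Bool, (w = false :: v ∧ v ∈ A) ∨ (w = true :: v ∧ g v = true)}

/-- `[] ∉ A ⊕ g`. [folklore] -/
theorem nil_not_mem_comb (A : Set (List Bool)) (g : List Bool → Bool) : [] ∉ comb A g := by
  rintro ⟨v, ⟨h, -⟩ | ⟨h, -⟩⟩ <;> cases h

/-- `false :: v ∈ A ⊕ g ↔ v ∈ A`. [folklore] -/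
theorem false_cons_mem_comb (A : Set (List Bool)) (g : List Bool → Bool) (v : List Bool) :
    false :: v ∈ comb A g ↔ v ∈ A := by
  constructor
  · rintro ⟨v', ⟨h, hv⟩ | ⟨h, -⟩⟩
    · cases h; exact hv
    · cases h
  · exact fun h => ⟨v, Or.inl ⟨rfl, h⟩⟩

/-- `true :: v ∈ A ⊕ g ↔ g v = true`. [folklore] -/
theorem true_cons_mem_comb (A : Set (List Bool)) (g : List Bool → Bool) (v : List Bool) :
    true :: v ∈ comb A g ↔ g v = true := by
  constructor
  · rintro ⟨v', ⟨h, -⟩ | ⟨h, hv⟩⟩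
    · cases h
    · cases h; exact hv
  · exact fun h => ⟨v, Or.inr ⟨rfl, h⟩⟩

/-! ### One more answer bit does not change the verdict -/

/-- The first `m` answer bits of `m + 1` queries. [folklore] -/
theorem take_ttBits_succ (Qg : List Bool → List Bool) (A : Language Bool) (x : List Bool) (m : ℕ) :
    (ttBits Qg A x (m + 1)).take m = ttBits Qg A x m := by
  rw [ttBits_succ, List.take_left' (length_ttBits _ _ _)]

/-! ### The single-string error over the random oracle -/

/-- **The single-string error is a counting probability over the coin window.** For an instance `z` whose
verdict depends on the first `p''(|z|)` coins only, the event "the verdict of `L''` on `z` with the oracle's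
bits at `⟨z, 1ⁱ⟩`, `i ≤ p''(|z|)`, as coins differs from `good`" has random-oracle measure equal to the
counting probability of the corresponding set of coin strings of length `p''(|z|)`
(`BPPAlmostP.toReal_measure_setOf_err`: the window bits are independent fair coins).
[cite: BookVollmerWagner1996, §3 Prop. 1–2 (p. 373–374)] -/
theorem measure_err_eq {L'' : Language Bool} {p'' : Polynomial ℕ}
    (htake : ∀ z y : List Bool, ∀ N, p''.eval z.length ≤ N → (boolPair z (y.take N) ∈ L'' ↔ boolPair z y ∈ L''))
    (z : List Bool) (good : Prop) :
    (randomOracleMeasure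
        {A : Set (List Bool) | ¬ (boolPair z (ttBits id A z (p''.eval z.length + 1)) ∈ L'' ↔ good)}).toReal =
      uniformProb (p''.eval z.length) {y | ¬ (boolPair z y ∈ L'' ↔ z ∈ ({_w : List Bool | good} : Language Bool))} := by
  have hset : {A : Set (List Bool) | ¬ (boolPair z (ttBits id A z (p''.eval z.length + 1)) ∈ L'' ↔ good)} =
      {A : Set (List Bool) | ¬ (z ∈ ttLang id p'' L'' A ↔ z ∈ ({_w : List Bool | good} : Language Bool))} := by
    ext A
    simp only [Set.mem_setOf_eq, mem_ttLang_iff]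
    rw [← htake z (ttBits id A z (p''.eval z.length + 1)) (p''.eval z.length) le_rfl, take_ttBits_succ]
  rw [hset]
  exact BPPAlmostP.toReal_measure_setOf_err _ L'' p'' z

/-- **The single-string error bound.** If `z` is a YES instance with rejection probability `≤ ε` (when
`good`) or a NO instance with acceptance probability `≤ ε` (when `¬ good`), the event of `measure_err_eq`
has measure `≤ ε`. [cite: BennettGill1981, Thm. 5] -/
theorem measure_err_le {L'' : Language Bool} {p'' : Polynomial ℕ}
    (htake : ∀ z y : List Bool, ∀ N, p''.eval z.length ≤ N → (boolPair z (y.take N) ∈ L'' ↔ boolPair z y ∈ L''))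
    (z : List Bool) (good : Prop) {ε : ℝ} (hε : 0 ≤ ε)
    (hz : (good ∧ uniformProb (p''.eval z.length) {y | boolPair z y ∉ L''} ≤ ε) ∨
      (¬ good ∧ uniformProb (p''.eval z.length) {y | boolPair z y ∈ L''} ≤ ε)) :
    randomOracleMeasure
        {A : Set (List Bool) | ¬ (boolPair z (ttBits id A z (p''.eval z.length + 1)) ∈ L'' ↔ good)} ≤
      ENNReal.ofReal ε := by
  rw [ENNReal.le_ofReal_iff_toReal_le (measure_ne_top _ _) hε, measure_err_eq htake z good]
  rcases hz with ⟨hg, h⟩ | ⟨hg, h⟩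
  · have hset : {y : List Bool | ¬ (boolPair z y ∈ L'' ↔ z ∈ ({_w : List Bool | good} : Language Bool))} =
        {y | boolPair z y ∉ L''} := by
      ext y
      simp only [Set.mem_setOf_eq, hg, iff_true]
    rwa [hset]
  · have hset : {y : List Bool | ¬ (boolPair z y ∈ L'' ↔ z ∈ ({_w : List Bool | good} : Language Bool))} =
        {y | boolPair z y ∈ L''} := by
      ext y
      simp only [Set.mem_setOf_eq, hg, iff_false, not_not]
    rwa [hset]

/-! ### The arithmetic of the union bound -/

/-- `2^{a+1} e^{-(a + b + c + 6)} ≤ 1/(b + 1)` (`2 ≤ e`, `y + 1 ≤ e^y`). [folklore] -/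
theorem union_bound_arith (a b c : ℕ) :
    (2 : ℝ) ^ (a + 1) * exp (-(((a + b + c + 1 : ℕ) : ℝ) + 5)) ≤ 1 / ((b : ℝ) + 1) := by
  have h2e : (2 : ℝ) ≤ exp 1 := by
    have := add_one_le_exp (1 : ℝ)
    linarith
  have hpow : (2 : ℝ) ^ (a + 1) ≤ exp ((a + 1 : ℕ) : ℝ) := by
    rw [← exp_one_pow]
    exact pow_le_pow_left₀ (by norm_num) h2e _
  have hb1 : ((b : ℝ) + 1) + 1 ≤ exp ((b : ℝ) + 1) := add_one_le_exp _
  have hbpos : (0 : ℝ) < (b : ℝ) + 1 := by positivity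
  calc (2 : ℝ) ^ (a + 1) * exp (-(((a + b + c + 1 : ℕ) : ℝ) + 5))
      ≤ exp ((a + 1 : ℕ) : ℝ) * exp (-(((a + b + c + 1 : ℕ) : ℝ) + 5)) :=
        mul_le_mul_of_nonneg_right hpow (exp_nonneg _)
    _ = exp (-((b : ℝ) + 1)) * exp (-((c : ℝ) + 4)) := by
        rw [← exp_add, ← exp_add]
        congr 1
        push_cast
        ring
    _ ≤ exp (-((b : ℝ) + 1)) * 1 := by
        refine mul_le_mul_of_nonneg_left ?_ (exp_nonneg _)
        rw [exp_le_one_iff]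
        have : (0 : ℝ) ≤ c := Nat.cast_nonneg c
        linarith
    _ = (exp ((b : ℝ) + 1))⁻¹ := by rw [mul_one, exp_neg]
    _ ≤ (((b : ℝ) + 1) + 1)⁻¹ := inv_anti₀ (by positivity) hb1
    _ ≤ 1 / ((b : ℝ) + 1) := by
        rw [one_div]
        exact inv_anti₀ hbpos (by linarith)

end FarCoin

open FarCoin

/-! ### The stub -/

/-- **Stub `stub_promiseOracleElimination` of the line `birth` of crux `TransferPB`** (registered signature
`Sig.stub_promiseOracleElimination`): PROMISE-`BPP'` ORACLE ELIMINATION relative to a random oracle. For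
`Q ∈ PromiseBPP'`, a polynomial-time transcript machine `C` with budget `q` consulting `A ⊕ g`, and polynomials
`ℓ, r`, there are a polynomial-time `C'` and `q'` (all queries of `C'` of length `≤ q'`) such that for every
input `x` of length `n ≥ 1` there are a finite window `V` of strings longer than `ℓ(n)` and answer functions
`ĝ(A) = ĝ(A ∩ V)` with `C'^{A}(x) = C^{A ⊕ ĝ(A)}(x)` on every halting run and
`Pr_A[ĝ(A) violates the promise of Q] ≤ 1/(r(n)+1)` — Bennett–Gill's coins read off far oracle positions,
exponential amplification, and the union bound over the short strings. [cite: BennettGill1981, Thm. 5]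
[cite: BookVollmerWagner1996, §4 Thm. 3] [cite: AroraBarak2009, Thm. 7.10 and §7.4.1] -/
theorem stub_promiseOracleElimination : Sig.stub_promiseOracleElimination := by
  intro Q hQ C q hC hqC ℓ r
  classical
  obtain ⟨L'', hL'', p'', hyes, hno, htake⟩ := exists_amplifier Q hQ
  have hdisj : Q.Disjoint := PromiseProblem.disjoint_of_mem_PromiseBPP' hQ
  set T : Polynomial ℕ := q + r + ℓ + 1 with hT
  have hT_eval : ∀ m, T.eval m = q.eval m + r.eval m + ℓ.eval m + 1 := fun m => by simp [hT]
  set k : Polynomial ℕ := p'' + 1 with hk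
  have hk_eval : ∀ m, k.eval m = p''.eval m + 1 := fun m => by simp [hk]
  obtain ⟨sR, hsR⟩ := exists_queryBound_disp L'' k
  obtain ⟨C', q', hC', hq', hsimul⟩ := exists_simulator hC q T
    (isPolyTime_ttFnAlg (q := k) dispQ_mem_FP (dispG_mem_FP hL'')) (k + 1) hsR
  refine ⟨C', q', hC', hq', fun x _ => ?_⟩
  -- the tag, the tagged instances, the simulated answers, the window
  set t : List Bool := ones (T.eval x.length) with ht
  have ht_len : t.length = T.eval x.length := by simp [ht, ones]
  set tag : List Bool → List Bool := fun v => boolPair (true :: v) t with htag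
  have htag_len : ∀ v, (tag v).length = 2 * v.length + 4 + T.eval x.length := fun v => by
    simp only [htag, length_boolPair, List.length_cons, ht_len]; ring
  set sim : Set (List Bool) → List Bool → Bool := fun A v =>
    L''.boolIndicator (boolPair (tag v) (ttBits id A (tag v) (k.eval (tag v).length))) with hsim
  set ĝ : Set (List Bool) → List Bool → Bool := fun A v =>
    if v.length < q.eval x.length then sim A v else Q.yes.boolIndicator v with hĝ
  set addr : List Bool → ℕ → List Bool := fun v i => boolPair (tag v) (List.replicate i true) with haddr
  set V : Finset (List Bool) := (PromiseCook.shortStrings (q.eval x.length)).biUnion fun v =>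
    (range (k.eval (tag v).length)).image (addr v) with hV
  have hmemV : ∀ v : List Bool, v.length < q.eval x.length → ∀ i < k.eval (tag v).length, addr v i ∈ V :=
    fun v hv i hi => mem_biUnion.2 ⟨v, PromiseCook.mem_shortStrings hv.le, mem_image.2 ⟨i, mem_range.2 hi, rfl⟩⟩
  refine ⟨V, ĝ, ?_, ?_, ?_, ?_⟩
  · -- (1) the window is far: every address is longer than `ℓ(n)`
    intro w hw
    obtain ⟨v, -, hw⟩ := mem_biUnion.1 hw
    obtain ⟨i, -, rfl⟩ := mem_image.1 hw
    simp only [haddr, length_boolPair, htag_len, List.length_replicate, hT_eval]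
    omega
  · -- (2) `ĝ(A)` reads only the window
    intro A
    funext v
    simp only [hĝ]
    split_ifs with hv
    · simp only [hsim, ttBits]
      congr 2
      refine List.map_congr_left fun i hi => ?_
      exact boolIndicator_congr ⟨fun h => ⟨h, hmemV v hv i (List.mem_range.1 hi)⟩, fun h => h.1⟩
    · rfl
  · -- (3) the simulation: `C'` with `A` reproduces `C` with `A ⊕ ĝ(A)`
    intro A b hrun
    refine hsimul A (Oracle.ofLanguage (comb A (ĝ A))) x b (fun u hu => ?_) hrun (hqC _ x)
    rw [subAnswer_disp]
    rcases u with _ | ⟨c, v⟩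
    · rw [ttFn_disp_nil, Oracle.ofLanguage_apply, (Set.notMem_iff_boolIndicator _ _).1 (nil_not_mem_comb A (ĝ A))]
      rfl
    · cases c
      · rw [ttFn_disp_false A v t (by rw [hk_eval]; omega), Oracle.ofLanguage_apply, Oracle.ofLanguage_apply]
        refine congrArg encodeBool ?_
        by_cases hvA : v ∈ A
        · rw [(Set.mem_iff_boolIndicator _ _).1 hvA,
            (Set.mem_iff_boolIndicator _ _).1 ((false_cons_mem_comb A (ĝ A) v).2 hvA)]
        · rw [(Set.notMem_iff_boolIndicator _ _).1 hvA,
            (Set.notMem_iff_boolIndicator _ _).1 fun h => hvA ((false_cons_mem_comb A (ĝ A) v).1 h)]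
      · have hv : v.length < q.eval x.length := by simp only [List.length_cons] at hu; omega
        rw [ttFn_disp_true A v t, Oracle.ofLanguage_apply]
        refine congrArg encodeBool ?_
        have hĝv : ĝ A v = sim A v := by simp only [hĝ, if_pos hv]
        rw [Bool.eq_iff_iff, ← Set.mem_iff_boolIndicator, ← Set.mem_iff_boolIndicator, true_cons_mem_comb, hĝv,
          hsim, ← Set.mem_iff_boolIndicator]
  · -- (4) the promise is violated with probability `≤ 1/(r(n)+1)`
    change randomOracleMeasure _ ≤ _
    set Bad : List Bool → Set (Set (List Bool)) := fun v =>
      {A | (v ∈ Q.yes ∧ ĝ A v = false) ∨ (v ∈ Q.no ∧ ĝ A v = true)} with hBad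
    have hsub : {A : Set (List Bool) | ¬ ((∀ v ∈ Q.yes, ĝ A v = true) ∧ (∀ v ∈ Q.no, ĝ A v = false))} ⊆
        ⋃ v ∈ PromiseCook.shortStrings (q.eval x.length), Bad v := by
      intro A hA
      simp only [Set.mem_setOf_eq] at hA
      rw [Set.mem_iUnion₂]
      by_contra hcon
      push Not at hcon
      apply hA
      constructor
      · intro v hv
        by_cases hvl : v.length < q.eval x.length
        · by_contra hne
          exact hcon v (PromiseCook.mem_shortStrings hvl.le) (Or.inl ⟨hv, by simpa using hne⟩)
        · simp only [hĝ, if_neg hvl]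
          exact (Set.mem_iff_boolIndicator _ _).1 hv
      · intro v hv
        by_cases hvl : v.length < q.eval x.length
        · by_contra hne
          exact hcon v (PromiseCook.mem_shortStrings hvl.le) (Or.inr ⟨hv, by simpa using hne⟩)
        · simp only [hĝ, if_neg hvl]
          exact (Set.notMem_iff_boolIndicator _ _).1 fun h => Set.disjoint_left.1 hdisj h hv
    -- the single-string bound
    have hone : ∀ v ∈ PromiseCook.shortStrings (q.eval x.length),
        randomOracleMeasure (Bad v) ≤ ENNReal.ofReal (exp (-(((T.eval x.length : ℕ) : ℝ) + 5))) := by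
      intro v _
      by_cases hvl : v.length < q.eval x.length
      · by_cases hprom : v ∈ Q.yes ∨ v ∈ Q.no
        · -- on the promise: the error event of the amplified decider on `tag v`
          have hsubv : Bad v ⊆ {A : Set (List Bool) |
              ¬ (boolPair (tag v) (ttBits id A (tag v) (p''.eval (tag v).length + 1)) ∈ L'' ↔ v ∈ Q.yes)} := by
            intro A hA
            have hĝv : ĝ A v = sim A v := by simp only [hĝ, if_pos hvl]
            simp only [Set.mem_setOf_eq, hBad, hĝv, hsim, hk_eval] at hA ⊢
            rcases hA with ⟨hy, hf⟩ | ⟨hno', htr⟩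
            · rw [← Set.notMem_iff_boolIndicator] at hf
              exact fun h => hf (h.2 hy)
            · rw [← Set.mem_iff_boolIndicator] at htr
              exact fun h => Set.disjoint_left.1 hdisj (h.1 htr) hno'
          refine (measure_mono hsubv).trans ?_
          have hlen : exp (-(((tag v).length : ℝ) + 1)) ≤ exp (-(((T.eval x.length : ℕ) : ℝ) + 5)) := by
            rw [exp_le_exp, htag_len]
            push_cast
            linarith [(Nat.cast_nonneg v.length : (0 : ℝ) ≤ v.length)]
          refine (measure_err_le htake (tag v) (v ∈ Q.yes) (exp_nonneg _) ?_).trans (ENNReal.ofReal_le_ofReal hlen)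
          rcases hprom with hy | hno'
          · exact Or.inl ⟨hy, hyes v hy t⟩
          · exact Or.inr ⟨fun h => Set.disjoint_left.1 hdisj h hno', hno v hno' t⟩
        · -- off the promise: nothing to violate
          have hempty : Bad v = ∅ := by
            ext A
            simp only [hBad, Set.mem_setOf_eq, Set.mem_empty_iff_false, iff_false]
            push Not at hprom
            rintro (⟨hy, -⟩ | ⟨hno', -⟩)
            · exact hprom.1 hy
            · exact hprom.2 hno'
          rw [hempty, measure_empty]
          exact bot_le
      · -- long strings: `ĝ` is the truth
        have hempty : Bad v = ∅ := by
          ext A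
          simp only [hBad, Set.mem_setOf_eq, Set.mem_empty_iff_false, iff_false, hĝ, if_neg hvl]
          rintro (⟨hy, hf⟩ | ⟨hno', htr⟩)
          · exact absurd hf (by rw [(Set.mem_iff_boolIndicator _ _).1 hy]; decide)
          · exact Set.disjoint_left.1 hdisj ((Set.mem_iff_boolIndicator _ _).2 htr) hno'
        rw [hempty, measure_empty]
        exact bot_le
    -- the union bound
    have hcard : ((PromiseCook.shortStrings (q.eval x.length)).card : ℝ≥0∞) ≤ (2 : ℝ≥0∞) ^ (q.eval x.length + 1) := by
      exact_mod_cast PromiseCook.card_shortStrings_le (q.eval x.length)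
    calc randomOracleMeasure {A : Set (List Bool) | ¬ ((∀ v ∈ Q.yes, ĝ A v = true) ∧ (∀ v ∈ Q.no, ĝ A v = false))}
        ≤ randomOracleMeasure (⋃ v ∈ PromiseCook.shortStrings (q.eval x.length), Bad v) := measure_mono hsub
      _ ≤ ∑ v ∈ PromiseCook.shortStrings (q.eval x.length), randomOracleMeasure (Bad v) :=
          measure_biUnion_finset_le _ _
      _ ≤ ∑ _v ∈ PromiseCook.shortStrings (q.eval x.length), ENNReal.ofReal (exp (-(((T.eval x.length : ℕ) : ℝ) + 5))) :=
          sum_le_sum hone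
      _ = (PromiseCook.shortStrings (q.eval x.length)).card * ENNReal.ofReal (exp (-(((T.eval x.length : ℕ) : ℝ) + 5))) := by
          rw [sum_const, nsmul_eq_mul]
      _ ≤ (2 : ℝ≥0∞) ^ (q.eval x.length + 1) * ENNReal.ofReal (exp (-(((T.eval x.length : ℕ) : ℝ) + 5))) := by
          gcongr
      _ = ENNReal.ofReal ((2 : ℝ) ^ (q.eval x.length + 1) * exp (-(((T.eval x.length : ℕ) : ℝ) + 5))) := by
          rw [ENNReal.ofReal_mul (by positivity), ENNReal.ofReal_pow (by norm_num), ENNReal.ofReal_ofNat]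
      _ ≤ ENNReal.ofReal (1 / (((r.eval x.length : ℕ) : ℝ) + 1)) := by
          refine ENNReal.ofReal_le_ofReal ?_
          rw [hT_eval]
          exact union_bound_arith (q.eval x.length) (r.eval x.length) (ℓ.eval x.length)

end Summit.QuantumAdvantage.QuantumAdvantage.Cruxes.TransferPB.Birth

end
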